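import Summits.Ventures.HSemireg.WedgeHankelRecurrenceRouthHurwitzDeterminants
import Literature.Algebra.Polynomial.PolynomialShiftDifference

/-!
# Venture HSemireg — RELATIVE STABILITY (stability margin `σ`): ALL roots of a real `p` satisfy `Re z < σ` iff the SHIFTED polynomial `p(X + σ)` is Hurwitz, hence (N211) iff the Hurwitz
# determinants `Δ_k(p(X + σ)) > 0`, `k ≤ n` — the classical "shifted Routh–Hurwitz test" for a prescribed degree of stability

HONEST FRAMING. Part of the Lean index of the computation cell `pub-hsemireg` (seat p10 gen 39, Sunday typer «UNIFORM-IN-n»).  A change of variable on top of N211; no variety, no cohomology theory,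
no sheaf, no Ext group and no semiregularity map is constructed here; nothing here says that HC / HC_CM / HC_AV holds; no Literature fact (unproved `Prop`) is declared or used.  Custodian versions as in
`WedgeHankelSiegelIdeal` (1/3).
SOURCES (cited).  Gantmacher, *The Theory of Matrices* II, Ch. XV §6 (the determinant criterion) and §14 (domain-of-stability remarks); Hairer–Nørsett–Wanner I §I.13; the shift `s ↦ s + σ` for a
prescribed stability margin is textbook control practice (e.g. Ogata, *Modern Control Engineering*, §5-6 «relative stability analysis»).
DEDUP DISCLOSURE (`rg`, 2026-09-02): `p(X + a) ≠ 0`, `deg p(X + a) = deg p`, `lc p(X + a) = lc p` EXIST as `Literature.Algebra.Polynomial.PolynomialShiftDifference.comp_X_add_C_ne_zero ∕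
natDegree_comp_X_add_C ∕ leadingCoeff_comp_X_add_C` (fields) — IMPORTED AND USED, not restated; root sets of `p.comp (X + C σ)` vs `p` — no statement in the tree; the 3 names below: 0 hits tree-wide.

WHAT IS IN THE TREE.  N211: `forall_re_neg_iff_forall_det_hurwitzMatrix_pos`.  Literature `PolynomialShiftDifference`: `comp_X_add_C_ne_zero`, `natDegree_comp_X_add_C`, `leadingCoeff_comp_X_add_C`.
Mathlib: `map_comp`, `eval_comp`, `mem_roots`.
THIS FILE (namespace `Summit.Ventures.HSemireg.Wedge.HankelOuter` continued; PLAIN over N211 + Literature `PolynomialShiftDifference`; 0 definitions):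
* §950 `mem_roots_map_comp_X_add_C_iff` (`z` root of `p(X+σ)_ℂ` iff `z + σ` root of `p_ℂ`), **`forall_re_lt_iff_forall_re_neg_comp_X_add_C`**
  (`(∀ roots, Re < σ) ↔ p(X + σ)` Hurwitz), **`forall_re_lt_iff_forall_det_hurwitzMatrix_comp_pos`** (`… ↔ ∀ k ≤ n, 0 < Δ_k(p(X + σ))`, `0 < lc p`).
CAVEATS.  Real coefficients, roots in `ℂ` with multiplicity; the margin is an open half-plane `Re z < σ` (any real `σ`).  Nothing Ext-side.  New names only.
-/

open Polynomial
open scoped Polynomial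

namespace Summit.Ventures.HSemireg.Wedge.HankelOuter

/-! ## §950. Relative stability by a shift of the variable -/

/-- **Roots of the shift**: for a real `p ≠ 0`, `z` is a root of `p(X + σ)` over `ℂ` iff `z + σ` is a root of `p` over `ℂ`. [this file, §950] -/
theorem mem_roots_map_comp_X_add_C_iff {p : ℝ[X]} (hp : p ≠ 0) (σ : ℝ) (z : ℂ) :
    z ∈ ((p.comp (X + C σ)).map (algebraMap ℝ ℂ)).roots ↔ z + (σ : ℂ) ∈ (p.map (algebraMap ℝ ℂ)).roots := by
  have hp' : p.map (algebraMap ℝ ℂ) ≠ 0 := (Polynomial.map_ne_zero_iff (RingHom.injective _)).2 hp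
  have hq' : (p.comp (X + C σ)).map (algebraMap ℝ ℂ) ≠ 0 := (Polynomial.map_ne_zero_iff (RingHom.injective _)).2 (Literature.Algebra.Polynomial.PolynomialShiftDifference.comp_X_add_C_ne_zero hp σ)
  rw [mem_roots hq', mem_roots hp', IsRoot.def, IsRoot.def, map_comp, Polynomial.map_add, map_X, map_C, eval_comp, eval_add, eval_X, eval_C]
  rfl

/-- **RELATIVE STABILITY: every root of the real `p` has `Re z < σ` iff the shifted polynomial `p(X + σ)` is Hurwitz** (`p = 0`: both sides vacuous). [shifted Routh–Hurwitz test; this file, §950] -/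
theorem forall_re_lt_iff_forall_re_neg_comp_X_add_C (p : ℝ[X]) (σ : ℝ) :
    (∀ z ∈ (p.map (algebraMap ℝ ℂ)).roots, z.re < σ) ↔ ∀ z ∈ ((p.comp (X + C σ)).map (algebraMap ℝ ℂ)).roots, z.re < 0 := by
  rcases eq_or_ne p 0 with rfl | hp
  · simp
  constructor
  · intro H z hz
    have h := H _ ((mem_roots_map_comp_X_add_C_iff hp σ z).1 hz)
    rw [Complex.add_re, Complex.ofReal_re] at h
    linarith
  · intro H z hz
    have hz' : z - (σ : ℂ) ∈ ((p.comp (X + C σ)).map (algebraMap ℝ ℂ)).roots := by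
      rw [mem_roots_map_comp_X_add_C_iff hp σ, sub_add_cancel]; exact hz
    have h := H _ hz'
    rw [Complex.sub_re, Complex.ofReal_re] at h
    linarith

/-- **SHIFTED ROUTH–HURWITZ DETERMINANT TEST: for a real `p` of degree `n` with `0 < lc p`, every root has `Re z < σ` iff `Δ_k(p(X + σ)) > 0` for all `k ≤ n`** (N211 applied to `p(X + σ)`, which
has the same degree and leading coefficient). [Gantmacher XV §6 (35) after the shift `s ↦ s + σ`; this file, §950] -/
theorem forall_re_lt_iff_forall_det_hurwitzMatrix_comp_pos {n : ℕ} {p : ℝ[X]} (hp : p.natDegree = n) (hlc : 0 < p.leadingCoeff) (σ : ℝ) :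
    (∀ z ∈ (p.map (algebraMap ℝ ℂ)).roots, z.re < σ) ↔ ∀ k ≤ n, 0 < (hurwitzMatrix k (p.comp (X + C σ))).det := by
  have hdeg : (p.comp (X + C σ)).natDegree = n := by rw [Literature.Algebra.Polynomial.PolynomialShiftDifference.natDegree_comp_X_add_C, hp]
  have hlc' : 0 < (p.comp (X + C σ)).leadingCoeff := by
    rwa [Literature.Algebra.Polynomial.PolynomialShiftDifference.leadingCoeff_comp_X_add_C]
  rw [forall_re_lt_iff_forall_re_neg_comp_X_add_C, forall_re_neg_iff_forall_det_hurwitzMatrix_pos hdeg hlc']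

end Summit.Ventures.HSemireg.Wedge.HankelOuter
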